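import Mathlib.Algebra.BigOperators.GroupWithZero.Finset
import Mathlib.Algebra.MvPolynomial.Degrees
import Mathlib.RingTheory.MvPolynomial.Homogeneous
import Literature.Computability.AlgebraicComplexity.PermanentCompleteness
import Literature.Computability.AlgebraicComplexity.CircuitArithmetizationExpr
import Literature.Computability.AlgebraicComplexity.GateQuotients
import Literature.Computability.AlgebraicComplexity.DepthReductionProofs
import Literature.Computability.AlgebraicComplexity.ArithCircuitProofs
import HarnessLib

/-!
# `VNP_e = VNP` (BCS 1997, Thm. (21.26)) — discharge of `BCS1997_thm_21_26`

D-0014 keeps `Literature/` free of `sorry` by stating cited results as named facts. This file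
proves the named fact `Literature.Computability.AlgebraicComplexity.BCS1997_thm_21_26` of
`PermanentCompleteness.lean` — Bürgisser–Clausen–Shokrollahi 1997, Thm. (21.26) (`VNP_e = VNP`,
Valiant 1982), in the form vendored there (the inclusion `VNP ⊆ VNP_e`, unfolded): every
p-definable family `f_n = ∑_{e ∈ {0,1}^{u(n)}} g_n(X, e)`, `g ∈ VP`, is a Boolean sum
`f_n = ∑_{e'} val(φ_n)(X, e')` of arithmetic expressions `φ_n` (BCS (21.19)) of p-bounded size in
p-boundedly many Boolean variables:

* `Literature.Computability.AlgebraicComplexity.BCS1997_thm_21_26_holds : BCS1997_thm_21_26 k`.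

This is the first of the three printed steps of Valiant's `VNP`-completeness of `PER` (assembly
`isVNPComplete_perPoly_of`).

## The printed proof and the one formalised

By Lemma (21.22) it suffices to show `VP ⊆ VNP_e` (the two Boolean sums are merged,
`boolSum_boolSum`). BCS prove `VP ⊆ VNP_e` (book pp. 552–555) by a recursion on homogeneous
straight-line programs: with `J` the multiplication instructions of degree `> d/2` whose arguments
have degree `≤ d/2`, `f_n = ∑_{j ∈ J} b_{α_j} b_{β_j} S_j` where `S_j` is the "quotient" of `f_n`
by the instruction `j` (Claim 1, computed by the modified program `Γ'`), the `b_i` are packed into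
one polynomial `T(X, v)` with selector variables and the admissible index triples are selected by
the Boolean polynomial `R(z, v, v', e)`, giving (E) `f_n = ∑_{(z,v,v',e)} T T S R` and the recursion
`A(C, d, m) ≤ 3 A(4C + d/2, d/2 + 1, m + C) + γ C²` of depth `log d`. We formalise the same
recursion in the language of the gate quotients `[ν : μ]` of Valiant–Skyum–Berkowitz–Rackoff
already in the tree (`GateQuotients.lean`: homogeneous circuit certificates `HomCircuit`, the
homogenization `SLP.homogenize` of a straight-line program = Lemma (21.25), the frontier
identities `val_eq_sum_frontier` / `quot_eq_sum_frontier` = Claim 1/(D)): one expansion step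
(`HomCircuit.xexpand`, `sum_prod_expand`) writes a node `[ν]` of formal degree `D` as
`∑_{γ ∈ F_{D/2}} [ν:γ]·[γ₁]·[γ₂]` and a quotient `[ν:μ]` of degree difference `D` as
`∑_{γ} [ν:γ]·[light γ]·[heavy γ:μ]`, all atoms of the right-hand side having halved measure
within two rounds (`IsGood`, `isGood_expand`); after `R = 2(log₂ d + 1)` rounds every atom has a
value of total degree `≤ 1` (`totalDegree_xval_le_one`), i.e. an affine form, which is an
expression of size `2n + 1` (`ArithExpr.affineExpr`). The selector variables `v, v', e, z` of
print become Boolean variables NAMING the atom and the frontier choice at every position of the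
complete ternary recursion tree (`TVars`, one-hot codes `oneHot`), the polynomial `R` of print
becomes the product of the local consistency indicators (`treeChk`, `ArithExpr.indic`), and (E)
becomes the tree identity `fiberSum_eq`: the Boolean sum over all assignments with prescribed root
collapses, level by level, to the iterated expansion value `treeVal`, which is the value of the
root atom (`hTreeVal_eq`). Summing the `d + 1` homogeneous components of `g` (the roots
`(i, Q_e)` of the homogenized certificate) gives `g` (`exists_expr_boolSum_of_circuit`), with
`m ≤ vnpeVars s d` Boolean variables and size `≤ vnpeSize s d n`, explicit polynomials in the
circuit size `s`, the degree `d` and the number `n` of variables (`3^R ≤ 9 (d+1)^4`,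
`#nodes ≤ 4 s (d+1)²`); p-boundedness along a `VP` family is `isPBounded_vnpeVars` /
`isPBounded_vnpeSize`, and the family statement follows with a size-`L(g_n)` circuit for each
`g_n` (`ArithCircuit.exists_computes_size_eq_complexity`).

## Contents

* Expression toolkit (`ArithExpr.rename` from `CircuitArithmetizationExpr.lean`): `lsum`/`fsum` (list products `listProd` and literals `litE` are imported from
  `CircuitArithmetizationExpr.lean`), Boolean points `bpoint`,
  `ArithExpr.beval` (`boolSum_eq_sum_beval`), `ArithExpr.literal`/`indic` (`beval_indic`),
  `affinePart`/`ArithExpr.affineExpr` (`affinePart_eq_of_totalDegree_le_one`).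
* The generic Boolean expansion tree: `TVars`, `rootA`/`rootC`/`childVar`, `treeChk`, `treeExpr`,
  `treeVal`, `fiberSum`, `fiberSum_eq`, `sum_beval_select_treeExpr`, size and variable counts.
* The certificate tree: `HomCircuit.XAtom`, `xval`, `xexpand`, `sum_prod_expand`, `IsGood`,
  `isGood_expand`, `hTreeExpr`, `sum_beval_hTreeExpr`, `size_hTreeExpr_le`.
* `exists_expr_boolSum_of_circuit`, `boolSum_boolSum`, `BCS1997_thm_21_26_holds`.

## References

* P. Bürgisser, M. Clausen, M. A. Shokrollahi, *Algebraic Complexity Theory*, Grundlehren 315,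
  Springer 1997, §21.2: (21.21)–(21.26) and the proof of Thm. (21.26), pp. 551–555.
* L. G. Valiant, *Reducibility by algebraic projections*, L'Enseignement Math. 28 (1982), 253–268.
* L. G. Valiant, S. Skyum, S. Berkowitz, C. Rackoff, *Fast parallel computation of polynomials
  using few processors*, SIAM J. Comput. 12 (1983) 641–644 (gate quotients, frontier identities).
-/

noncomputable section

open MvPolynomial Finset

namespace Literature.Computability.AlgebraicComplexity

universe u v w

namespace ArithExpr

variable {k : Type u} {σ : Type v} {τ : Type w}

variable [CommSemiring k]

/-- Iterated sum of a list of expressions (`const 0` for the empty list). [cite: BurgisserClausenShokrollahi1997, (21.19)] -/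
def lsum : List (ArithExpr k σ) → ArithExpr k σ
  | [] => const 0
  | φ :: l => add φ (lsum l)

/-- Value of an iterated sum. [cite: BurgisserClausenShokrollahi1997, (21.19)] -/
@[simp] theorem eval_lsum (l : List (ArithExpr k σ)) : (lsum l).eval = (l.map eval).sum := by
  induction l with
  | nil => simp [lsum]
  | cons φ l ih => simp [lsum, ih]

/-- Size of an iterated sum: the sizes plus one addition per summand. [cite: BurgisserClausenShokrollahi1997, (21.19)] -/
@[simp] theorem size_lsum (l : List (ArithExpr k σ)) : (lsum l).size = (l.map size).sum + l.length := by
  induction l with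
  | nil => simp [lsum]
  | cons φ l ih => simp [lsum, ih]; omega

/-- Sum of expressions over a `Finset`. [cite: BurgisserClausenShokrollahi1997, (21.19)] -/
def fsum {ι : Type*} (s : Finset ι) (f : ι → ArithExpr k σ) : ArithExpr k σ := lsum (s.toList.map f)

/-- Value of a `Finset` sum of expressions. [cite: BurgisserClausenShokrollahi1997, (21.19)] -/
@[simp] theorem eval_fsum {ι : Type*} (s : Finset ι) (f : ι → ArithExpr k σ) :
    (fsum s f).eval = ∑ i ∈ s, (f i).eval := by
  rw [fsum, eval_lsum, List.map_map, ← Finset.sum_map_toList s (fun i => (f i).eval)]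
  rfl

/-- Size of a `Finset` sum of expressions. [cite: BurgisserClausenShokrollahi1997, (21.19)] -/
@[simp] theorem size_fsum {ι : Type*} (s : Finset ι) (f : ι → ArithExpr k σ) :
    (fsum s f).size = ∑ i ∈ s, (f i).size + s.card := by
  rw [fsum, size_lsum, List.map_map, ← Finset.sum_map_toList s (fun i => (f i).size),
    List.length_map, Finset.length_toList]
  rfl

end ArithExpr

/-! ### Boolean points -/

section Boolean

variable {k : Type u} [CommRing k] {τ : Type v} {β : Type w}

/-- The Boolean point `(X, e)`: the variables `τ` stay, the Boolean variables `β` are set to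
`e ∈ {0,1}^β` (Bürgisser 2000, Def. 2.5; BCS 1997, (21.8)). [cite: BurgisserClausenShokrollahi1997, (21.8)] -/
def bpoint (e : β → Bool) : τ ⊕ β → MvPolynomial τ k :=
  Sum.elim X fun b => if e b then 1 else 0

/-- The Boolean point on an `X`-variable. [cite: BurgisserClausenShokrollahi1997, (21.8)] -/
@[simp] theorem bpoint_inl (e : β → Bool) (i : τ) : (bpoint e (Sum.inl i) : MvPolynomial τ k) = X i := rfl

/-- The Boolean point on a Boolean variable. [cite: BurgisserClausenShokrollahi1997, (21.8)] -/
@[simp] theorem bpoint_inr (e : β → Bool) (b : β) :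
    (bpoint e (Sum.inr b) : MvPolynomial τ k) = if e b then 1 else 0 := rfl

/-- The value `val(φ)(X, e)` of an expression at a Boolean point. [cite: BurgisserClausenShokrollahi1997, (21.8)] -/
abbrev ArithExpr.beval (e : β → Bool) (φ : ArithExpr k (τ ⊕ β)) : MvPolynomial τ k :=
  aeval (bpoint e) φ.eval

/-- Valiant's Boolean sum of the value of an expression is the sum of its values at the Boolean
points. [cite: BurgisserClausenShokrollahi1997, (21.8)] -/
theorem boolSum_eq_sum_beval {m : ℕ} (φ : ArithExpr k (τ ⊕ Fin m)) :
    boolSum φ.eval = ∑ e : Fin m → Bool, φ.beval e := rfl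

/-- Renaming the Boolean variables along `ι : β' → β` is evaluating at `e ∘ ι`. [cite: BurgisserClausenShokrollahi1997, (21.8)] -/
theorem ArithExpr.beval_rename_map {β' : Type*} (e : β → Bool) (ι : β' → β) (φ : ArithExpr k (τ ⊕ β')) :
    (φ.rename (Sum.map id ι)).beval e = φ.beval (e ∘ ι) := by
  simp only [ArithExpr.beval, ArithExpr.eval_rename, aeval_rename]
  congr 2
  funext x
  rcases x with i | b <;> simp [bpoint]

/-- An expression in the `X`-variables only evaluates to its value at every Boolean point. [cite: BurgisserClausenShokrollahi1997, (21.8)] -/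
theorem ArithExpr.beval_rename_inl (e : β → Bool) (φ : ArithExpr k τ) :
    (φ.rename (Sum.inl : τ → τ ⊕ β)).beval e = φ.eval := by
  simp only [ArithExpr.beval, ArithExpr.eval_rename, aeval_rename]
  have : (bpoint (k := k) e ∘ (Sum.inl : τ → τ ⊕ β)) = X := by ext x; simp
  rw [this, aeval_X_left, AlgHom.id_apply]

/-- Transport of a Boolean sum along an equivalence of the Boolean variables. [cite: BurgisserClausenShokrollahi1997, (21.8)] -/
theorem sum_beval_rename_equiv {β' : Type*} [Fintype β] [Fintype β'] [DecidableEq β] [DecidableEq β']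
    (θ : β ≃ β')
    (φ : ArithExpr k (τ ⊕ β)) :
    ∑ e' : β' → Bool, (φ.rename (Sum.map id θ)).beval e' = ∑ e : β → Bool, φ.beval e := by
  refine Fintype.sum_equiv (θ.arrowCongr (Equiv.refl Bool)).symm _ _ fun e' => ?_
  rw [ArithExpr.beval_rename_map]
  rfl

end Boolean

/-! ### Indicator expressions of bit patterns -/

section Indicator

variable {k : Type u} [CommRing k] {τ : Type v} {β : Type w}

namespace ArithExpr

/-- The literal of one bit: `Y_y` if the bit is `1`, `1 - Y_y` if it is `0` (value `1` at a
Boolean point iff the point has that bit); this is `CircuitArith.litE q (var (Sum.inr y))` of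
`CircuitArithmetizationExpr.lean`. [cite: BurgisserClausenShokrollahi1997, Thm. (21.26)] -/
abbrev literal (y : β) (q : Bool) : ArithExpr k (τ ⊕ β) :=
  CircuitArith.litE q (var (Sum.inr y))

/-- A literal has size at most `2` (`CircuitArith.size_litE_le`). [cite: BurgisserClausenShokrollahi1997, Thm. (21.26)] -/
theorem size_literal_le (y : β) (q : Bool) : (literal (k := k) (τ := τ) y q).size ≤ 2 := by
  simpa using CircuitArith.size_litE_le q (var (k := k) (Sum.inr y : τ ⊕ β))

/-- Value of a literal at a Boolean point. [cite: BurgisserClausenShokrollahi1997, Thm. (21.26)] -/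
theorem beval_literal (e : β → Bool) (y : β) (q : Bool) :
    (literal (k := k) (τ := τ) y q).beval e = if e y = q then 1 else 0 := by
  unfold literal beval
  rcases q with _ | _ <;> rcases h : e y with _ | _ <;> simp [CircuitArith.litE, ArithExpr.oneSub, h]

/-- The indicator expression of the bit pattern `q` on the Boolean variables `v 0, …, v (b-1)`:
the product of the corresponding literals. [cite: BurgisserClausenShokrollahi1997, Thm. (21.26)] -/
def indic {b : ℕ} (v : Fin b → β) (q : Fin b → Bool) : ArithExpr k (τ ⊕ β) :=
  listProd ((List.finRange b).map fun i => literal (v i) (q i))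

/-- Size of an indicator: at most `3 b`. [cite: BurgisserClausenShokrollahi1997, Thm. (21.26)] -/
theorem size_indic_le {b : ℕ} (v : Fin b → β) (q : Fin b → Bool) :
    (indic (k := k) (τ := τ) v q).size ≤ 3 * b := by
  rw [indic, size_listProd, List.map_map, List.length_map, List.length_finRange]
  have : ((List.finRange b).map (size ∘ fun i => literal (k := k) (τ := τ) (v i) (q i))).sum ≤ 2 * b := by
    have h := List.sum_le_card_nsmul ((List.finRange b).map (size ∘ fun i => literal (k := k) (τ := τ) (v i) (q i))) 2
      (fun x hx => by
        rw [List.mem_map] at hx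
        obtain ⟨i, -, rfl⟩ := hx
        exact size_literal_le (v i) (q i))
    simpa [mul_comm] using h
  omega

/-- Value of an iterated product at a Boolean point. [cite: BurgisserClausenShokrollahi1997, (21.8)] -/
theorem beval_listProd (e : β → Bool) (l : List (ArithExpr k (τ ⊕ β))) :
    (listProd l).beval e = (l.map (beval e)).prod := by
  rw [beval, eval_listProd, map_list_prod, List.map_map]
  rfl

omit [CommRing k] in
/-- A product of `0/1`-indicators is the indicator of the conjunction. [folklore] -/
theorem list_prod_map_ite {R : Type*} [CommSemiring R] {ι : Type*} (l : List ι) (P : ι → Prop) [DecidablePred P] :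
    (l.map fun i => if P i then (1 : R) else 0).prod = if ∀ i ∈ l, P i then 1 else 0 := by
  induction l with
  | nil => simp
  | cons a l ih =>
    rw [List.map_cons, List.prod_cons, ih]
    by_cases ha : P a <;> by_cases hl : ∀ i ∈ l, P i <;> simp [ha, hl]

/-- Value of an indicator at a Boolean point: `1` if the point has the pattern `q` on the
variables `v`, `0` otherwise. [cite: BurgisserClausenShokrollahi1997, Thm. (21.26)] -/
theorem beval_indic {b : ℕ} (e : β → Bool) (v : Fin b → β) (q : Fin b → Bool) :
    (indic (k := k) (τ := τ) v q).beval e = if e ∘ v = q then 1 else 0 := by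
  rw [indic, beval_listProd, List.map_map]
  have : ((List.finRange b).map (beval e ∘ fun i => literal (k := k) (τ := τ) (v i) (q i))) =
      (List.finRange b).map fun i => if e (v i) = q i then (1 : MvPolynomial τ k) else 0 := by
    apply List.map_congr_left
    intro i _
    exact beval_literal e (v i) (q i)
  rw [this, list_prod_map_ite]
  congr 1
  simp only [List.mem_finRange, forall_const, funext_iff, Function.comp_apply]

end ArithExpr

end Indicator

/-! ### The affine truncation -/

section Affine

variable {k : Type u} [CommSemiring k] {τ : Type v} [Fintype τ] [DecidableEq τ]

/-- The affine truncation `p ↦ p₀ + ∑_i p_{X_i} X_i` of a polynomial (its homogeneous components of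
degree `≤ 1`). [folklore] -/
def affinePart (p : MvPolynomial τ k) : MvPolynomial τ k :=
  C (coeff 0 p) + ∑ i, C (coeff (Finsupp.single i 1) p) * X i

omit [Fintype τ] [DecidableEq τ] in
/-- A monomial of degree `≤ 1` is `1` or a variable. [folklore] -/
theorem finsupp_eq_zero_or_single {m : τ →₀ ℕ} (h : (m.sum fun _ e => e) ≤ 1) :
    m = 0 ∨ ∃ j, m = Finsupp.single j 1 := by
  classical
  by_cases hm : m = 0
  · exact Or.inl hm
  · right
    obtain ⟨j, hj⟩ : ∃ j, m j ≠ 0 := by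
      by_contra hc
      push Not at hc
      exact hm (Finsupp.ext hc)
    have hle : ∀ i, m i ≤ m.sum (fun _ e => e) := fun i => by
      by_cases hi : i ∈ m.support
      · rw [Finsupp.sum]
        exact Finset.single_le_sum (fun i _ => Nat.zero_le (m i)) hi
      · rw [Finsupp.notMem_support_iff.1 hi]; exact Nat.zero_le _
    have hj1 : m j = 1 := by have := hle j; omega
    refine ⟨j, Finsupp.ext fun i => ?_⟩
    rw [Finsupp.single_apply]
    by_cases hij : j = i
    · subst hij; rw [if_pos rfl, hj1]
    · rw [if_neg hij]
      by_contra hi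
      have h2 : m j + m i ≤ m.sum (fun _ e => e) := by
        rw [Finsupp.sum]
        calc m j + m i = ∑ x ∈ ({j, i} : Finset τ), m x := by rw [Finset.sum_pair hij]
          _ ≤ ∑ x ∈ m.support, m x := by
            apply Finset.sum_le_sum_of_subset_of_nonneg
            · intro x hx
              simp only [Finset.mem_insert, Finset.mem_singleton] at hx
              rcases hx with rfl | rfl
              · exact Finsupp.mem_support_iff.2 hj
              · exact Finsupp.mem_support_iff.2 hi
            · intro _ _ _; exact Nat.zero_le _
      omega

omit [DecidableEq τ] in
/-- A polynomial of total degree `≤ 1` is its affine truncation. [folklore] -/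
theorem affinePart_eq_of_totalDegree_le_one {p : MvPolynomial τ k} (hp : p.totalDegree ≤ 1) :
    affinePart p = p := by
  classical
  ext m
  simp only [affinePart, coeff_add, coeff_C, coeff_sum, coeff_C_mul, coeff_X]
  by_cases hm0 : m = 0
  · subst hm0
    simp [Finsupp.single_eq_zero]
  · rw [if_neg (Ne.symm hm0), zero_add]
    by_cases hms : ∃ j, m = Finsupp.single j 1
    · obtain ⟨j, rfl⟩ := hms
      simp [Finsupp.single_left_inj (one_ne_zero)]
    · have h1 : ∀ i, ¬ Finsupp.single i 1 = m := fun i h => hms ⟨i, h.symm⟩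
      simp only [h1, if_false, mul_zero, Finset.sum_const_zero]
      symm
      by_contra hc
      have hmem : m ∈ p.support := by simpa [mem_support_iff] using hc
      rcases finsupp_eq_zero_or_single ((le_totalDegree hmem).trans hp) with h | ⟨j, hj⟩
      · exact hm0 h
      · exact hms ⟨j, hj⟩

variable (τ) in
/-- The affine truncation as an expression: `c₀ + ∑_i (c_i · X_i)`, of size `2 #τ + 1`. [folklore] -/
def ArithExpr.affineExpr (p : MvPolynomial τ k) : ArithExpr k τ :=
  ArithExpr.add (ArithExpr.const (coeff 0 p))
    (ArithExpr.fsum Finset.univ fun i => ArithExpr.mul (ArithExpr.const (coeff (Finsupp.single i 1) p)) (ArithExpr.var i))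

omit [DecidableEq τ] in
/-- The affine expression evaluates to the affine truncation. [folklore] -/
theorem ArithExpr.eval_affineExpr (p : MvPolynomial τ k) : (ArithExpr.affineExpr τ p).eval = affinePart p := by
  simp [ArithExpr.affineExpr, affinePart]

omit [DecidableEq τ] in
/-- The affine expression has size `2 #τ + 1`. [folklore] -/
theorem ArithExpr.size_affineExpr (p : MvPolynomial τ k) :
    (ArithExpr.affineExpr τ p).size = 2 * Fintype.card τ + 1 := by
  simp [ArithExpr.affineExpr, Finset.card_univ]
  ring

end Affine

/-! ### The Boolean expansion tree (generic) -/

section Tree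

variable {k : Type u} [CommRing k] {τ : Type v}

/-- The Boolean variables of the expansion tree of depth `r`: the `bA` bits naming the atom at
the root and, for `r ≥ 1`, the `bC` bits naming the choice at the root and the variables of the
three subtrees. [cite: BurgisserClausenShokrollahi1997, Thm. (21.26)] -/
@[reducible] def TVars (bA bC : ℕ) : ℕ → Type
  | 0 => Fin bA
  | r + 1 => (Fin bA ⊕ Fin bC) ⊕ (Fin 3 × TVars bA bC r)

/-- The tree variables form a finite type. [cite: BurgisserClausenShokrollahi1997, Thm. (21.26)] -/
instance TVars.instFintype (bA bC : ℕ) : (r : ℕ) → Fintype (TVars bA bC r)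
  | 0 => inferInstanceAs (Fintype (Fin bA))
  | r + 1 =>
    letI := TVars.instFintype bA bC r
    inferInstanceAs (Fintype ((Fin bA ⊕ Fin bC) ⊕ (Fin 3 × TVars bA bC r)))

/-- The tree variables have decidable equality. [cite: BurgisserClausenShokrollahi1997, Thm. (21.26)] -/
instance TVars.instDecidableEq (bA bC : ℕ) : (r : ℕ) → DecidableEq (TVars bA bC r)
  | 0 => inferInstanceAs (DecidableEq (Fin bA))
  | r + 1 =>
    letI := TVars.instDecidableEq bA bC r
    inferInstanceAs (DecidableEq ((Fin bA ⊕ Fin bC) ⊕ (Fin 3 × TVars bA bC r)))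

variable {bA bC : ℕ}

/-- The bits naming the atom at the root. [cite: BurgisserClausenShokrollahi1997, Thm. (21.26)] -/
def rootA : (r : ℕ) → Fin bA → TVars bA bC r
  | 0, i => i
  | _ + 1, i => Sum.inl (Sum.inl i)

/-- The bits naming the choice at the root. [cite: BurgisserClausenShokrollahi1997, Thm. (21.26)] -/
def rootC (r : ℕ) (i : Fin bC) : TVars bA bC (r + 1) := Sum.inl (Sum.inr i)

/-- The variables of the `j`-th subtree. [cite: BurgisserClausenShokrollahi1997, Thm. (21.26)] -/
def childVar (r : ℕ) (j : Fin 3) (v : TVars bA bC r) : TVars bA bC (r + 1) := Sum.inr (j, v)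

/-- Number of tree variables: `v₀ = bA`, `v_{r+1} = bA + bC + 3 v_r`. [cite: BurgisserClausenShokrollahi1997, Thm. (21.26)] -/
theorem card_TVars_succ (r : ℕ) :
    Fintype.card (TVars bA bC (r + 1)) = bA + bC + 3 * Fintype.card (TVars bA bC r) := by
  change Fintype.card ((Fin bA ⊕ Fin bC) ⊕ (Fin 3 × TVars bA bC r)) = _
  simp [Fintype.card_sum, Fintype.card_prod]

/-- Exact count of the tree variables: `2 v_r + (bA + bC) = 3^r (3 bA + bC)`. [cite: BurgisserClausenShokrollahi1997, Thm. (21.26)] -/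
theorem two_mul_card_TVars (r : ℕ) :
    2 * Fintype.card (TVars bA bC r) + (bA + bC) = 3 ^ r * (3 * bA + bC) := by
  induction r with
  | zero => change 2 * Fintype.card (Fin bA) + _ = _; simp; ring
  | succ r ih =>
    rw [card_TVars_succ, pow_succ]
    nlinarith

/-- Crude bound on the number of tree variables: `v_r ≤ 3^r (3 bA + bC)`. [cite: BurgisserClausenShokrollahi1997, Thm. (21.26)] -/
theorem card_TVars_le (r : ℕ) : Fintype.card (TVars bA bC r) ≤ 3 ^ r * (3 * bA + bC) := by
  have := two_mul_card_TVars (bA := bA) (bC := bC) r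
  omega

variable {At : Type*} [Fintype At] {Ch : Type*} [Fintype Ch]
variable (enc : At → Fin bA → Bool) (encC : Ch → Fin bC → Bool) (E : At → Ch → Fin 3 → At)
  (leaf : At → ArithExpr k τ)

/-- The local consistency check at the root of a tree of depth `r + 1`: the atom at the child `j`
is the `j`-th atom of the expansion of the atom at the root under the choice at the root. [cite: BurgisserClausenShokrollahi1997, Thm. (21.26)] -/
def treeChk (r : ℕ) : ArithExpr k (τ ⊕ TVars bA bC (r + 1)) :=
  ArithExpr.fsum Finset.univ fun a => ArithExpr.fsum Finset.univ fun c =>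
    ArithExpr.mul (ArithExpr.mul (ArithExpr.indic (rootA (r + 1)) (enc a)) (ArithExpr.indic (rootC r) (encC c)))
      (ArithExpr.listProd ((List.finRange 3).map fun j =>
        ArithExpr.indic (childVar r j ∘ rootA r) (enc (E a c j))))

/-- The tree expression of depth `r`: at depth `0` the leaf value selected by the atom bits; at
depth `r + 1` the local check times the three subtree expressions. [cite: BurgisserClausenShokrollahi1997, Thm. (21.26)] -/
def treeExpr : (r : ℕ) → ArithExpr k (τ ⊕ TVars bA bC r)
  | 0 => ArithExpr.fsum Finset.univ fun a =>
      ArithExpr.mul (ArithExpr.indic (rootA 0) (enc a)) ((leaf a).rename Sum.inl)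
  | r + 1 => ArithExpr.mul (treeChk enc encC E r)
      (ArithExpr.listProd ((List.finRange 3).map fun j => (treeExpr r).rename (Sum.map id (childVar r j))))

/-- The iterated expansion value `V_r(a)`: `V_0(a) = leaf value`, `V_{r+1}(a) = ∑_c ∏_j V_r(E a c j)`. [cite: BurgisserClausenShokrollahi1997, Thm. (21.26)] -/
def treeVal : ℕ → At → MvPolynomial τ k
  | 0, a => (leaf a).eval
  | r + 1, a => ∑ c, ∏ j : Fin 3, treeVal r (E a c j)

/-- The Boolean sum of the tree expression over the assignments with prescribed root atom bits. [cite: BurgisserClausenShokrollahi1997, Thm. (21.26)] -/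
def fiberSum (r : ℕ) (q : Fin bA → Bool) : MvPolynomial τ k :=
  ∑ e : TVars bA bC r → Bool, if e ∘ rootA r = q then (treeExpr enc encC E leaf r).beval e else 0

section Lemmas

variable {enc encC E leaf}

omit [Fintype At] [Fintype Ch] in
/-- `beval` is multiplicative. [cite: BurgisserClausenShokrollahi1997, (21.8)] -/
theorem beval_mul' {β : Type*} (e : β → Bool) (φ ψ : ArithExpr k (τ ⊕ β)) :
    (ArithExpr.mul φ ψ).beval e = φ.beval e * ψ.beval e := by
  simp [ArithExpr.beval]

omit [Fintype At] [Fintype Ch] in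
/-- `beval` of a `Finset` sum. [cite: BurgisserClausenShokrollahi1997, (21.8)] -/
theorem beval_fsum' {β ι : Type*} (e : β → Bool) (s : Finset ι) (f : ι → ArithExpr k (τ ⊕ β)) :
    (ArithExpr.fsum s f).beval e = ∑ i ∈ s, (f i).beval e := by
  simp [ArithExpr.beval, map_sum]

/-- Splitting an assignment of the variables of a tree of depth `r + 1` into the root atom bits,
the root choice bits and the assignments of the three subtrees. [cite: BurgisserClausenShokrollahi1997, Thm. (21.26)] -/
def splitAssign (r : ℕ) : (TVars bA bC (r + 1) → Bool) ≃
    ((Fin bA → Bool) × (Fin bC → Bool)) × (Fin 3 → TVars bA bC r → Bool) :=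
  (Equiv.sumArrowEquivProdArrow _ _ _).trans
    (Equiv.prodCongr (Equiv.sumArrowEquivProdArrow _ _ _) (Equiv.curry _ _ _))

omit [Fintype At] [Fintype Ch] in
/-- Auxiliary (splitAssign symm rootA). [cite: BurgisserClausenShokrollahi1997, Thm. (21.26)] -/
theorem splitAssign_symm_rootA (r : ℕ) (qa : Fin bA → Bool) (qc : Fin bC → Bool)
    (es : Fin 3 → TVars bA bC r → Bool) :
    ((splitAssign r).symm ((qa, qc), es)) ∘ rootA (r + 1) = qa := rfl

omit [Fintype At] [Fintype Ch] in
/-- Auxiliary (splitAssign symm rootC). [cite: BurgisserClausenShokrollahi1997, Thm. (21.26)] -/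
theorem splitAssign_symm_rootC (r : ℕ) (qa : Fin bA → Bool) (qc : Fin bC → Bool)
    (es : Fin 3 → TVars bA bC r → Bool) :
    ((splitAssign r).symm ((qa, qc), es)) ∘ rootC r = qc := rfl

omit [Fintype At] [Fintype Ch] in
/-- Auxiliary (splitAssign symm childVar). [cite: BurgisserClausenShokrollahi1997, Thm. (21.26)] -/
theorem splitAssign_symm_childVar (r : ℕ) (qa : Fin bA → Bool) (qc : Fin bC → Bool)
    (es : Fin 3 → TVars bA bC r → Bool) (j : Fin 3) :
    ((splitAssign r).symm ((qa, qc), es)) ∘ childVar r j = es j := rfl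

end Lemmas

section Identity

variable {enc encC E leaf}

omit [Fintype At] [Fintype Ch] in
/-- Reordering a fourfold sum. [folklore] -/
theorem sum_comm_four {α β γ δ M : Type*} [Fintype α] [Fintype β] [Fintype γ] [Fintype δ]
    [AddCommMonoid M] (f : α → β → γ → δ → M) :
    ∑ a, ∑ b, ∑ c, ∑ d, f a b c d = ∑ c, ∑ d, ∑ a, ∑ b, f a b c d := by
  calc ∑ a, ∑ b, ∑ c, ∑ d, f a b c d = ∑ a, ∑ c, ∑ b, ∑ d, f a b c d :=
        Finset.sum_congr rfl fun a _ => Finset.sum_comm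
    _ = ∑ c, ∑ a, ∑ b, ∑ d, f a b c d := Finset.sum_comm
    _ = ∑ c, ∑ a, ∑ d, ∑ b, f a b c d :=
        Finset.sum_congr rfl fun c _ => Finset.sum_congr rfl fun a _ => Finset.sum_comm
    _ = ∑ c, ∑ d, ∑ a, ∑ b, f a b c d := Finset.sum_congr rfl fun c _ => Finset.sum_comm

/-- The summand of the tree expression of depth `r + 1` at a split assignment. [cite: BurgisserClausenShokrollahi1997, Thm. (21.26)] -/
theorem beval_treeExpr_succ (r : ℕ) (q : Fin bA → Bool) (qc : Fin bC → Bool)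
    (es : Fin 3 → TVars bA bC r → Bool) :
    (treeExpr enc encC E leaf (r + 1)).beval ((splitAssign r).symm ((q, qc), es)) =
      ∑ a, ∑ c, ((if enc a = q then (1 : MvPolynomial τ k) else 0) * (if encC c = qc then 1 else 0)) *
        ∏ j : Fin 3, ((if es j ∘ rootA r = enc (E a c j) then (1 : MvPolynomial τ k) else 0) *
          (treeExpr enc encC E leaf r).beval (es j)) := by
  classical
  set e := (splitAssign r).symm ((q, qc), es) with he
  have hsub : (ArithExpr.listProd ((List.finRange 3).map fun j =>
      (treeExpr enc encC E leaf r).rename (Sum.map id (childVar r j)))).beval e =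
      ∏ j : Fin 3, (treeExpr enc encC E leaf r).beval (es j) := by
    rw [ArithExpr.beval_listProd, List.map_map, ← Fin.prod_univ_def]
    refine Finset.prod_congr rfl fun j _ => ?_
    exact ArithExpr.beval_rename_map _ _ _
  have hchk : (treeChk enc encC E r).beval e =
      ∑ a, ∑ c, ((if enc a = q then (1 : MvPolynomial τ k) else 0) * (if encC c = qc then 1 else 0)) *
        ∏ j : Fin 3, (if es j ∘ rootA r = enc (E a c j) then (1 : MvPolynomial τ k) else 0) := by
    rw [treeChk, beval_fsum']
    refine Finset.sum_congr rfl fun a _ => ?_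
    rw [beval_fsum']
    refine Finset.sum_congr rfl fun c _ => ?_
    rw [beval_mul', beval_mul', ArithExpr.beval_indic, ArithExpr.beval_indic,
      if_congr (show (e ∘ rootA (r + 1) = enc a) ↔ enc a = q by
        rw [he, splitAssign_symm_rootA]; exact eq_comm) rfl rfl,
      if_congr (show (e ∘ rootC r = encC c) ↔ encC c = qc by
        rw [he, splitAssign_symm_rootC]; exact eq_comm) rfl rfl,
      ArithExpr.beval_listProd, List.map_map, ← Fin.prod_univ_def]
    refine congrArg₂ (· * ·) rfl (Finset.prod_congr rfl fun j _ => ?_)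
    exact ArithExpr.beval_indic _ _ _
  rw [treeExpr, beval_mul', hchk, hsub, Finset.sum_mul]
  refine Finset.sum_congr rfl fun a _ => ?_
  rw [Finset.sum_mul]
  refine Finset.sum_congr rfl fun c _ => ?_
  rw [mul_assoc, ← Finset.prod_mul_distrib]

/-- The fibre sum at depth `r + 1`, as an iterated sum. [cite: BurgisserClausenShokrollahi1997, Thm. (21.26)] -/
theorem fiberSum_succ (r : ℕ) (q : Fin bA → Bool) :
    fiberSum enc encC E leaf (r + 1) q =
      ∑ a : At, ∑ c : Ch, ∑ qc : Fin bC → Bool, ∑ es : Fin 3 → TVars bA bC r → Bool,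
        ((if enc a = q then (1 : MvPolynomial τ k) else 0) * (if encC c = qc then 1 else 0)) *
          ∏ j : Fin 3, ((if es j ∘ rootA r = enc (E a c j) then (1 : MvPolynomial τ k) else 0) *
            (treeExpr enc encC E leaf r).beval (es j)) := by
  classical
  unfold fiberSum
  rw [← Fintype.sum_equiv (splitAssign r).symm
    (fun p => if p.1.1 = q then (treeExpr enc encC E leaf (r + 1)).beval ((splitAssign r).symm p) else 0)
    _ (fun p => if_congr Iff.rfl rfl rfl),
    Fintype.sum_prod_type, Fintype.sum_prod_type, Finset.sum_eq_single q]
  rotate_left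
  · exact fun b _ hb => Finset.sum_eq_zero fun x1 _ => Finset.sum_eq_zero fun x2 _ => if_neg hb
  · exact fun h => absurd (Finset.mem_univ _) h
  change (∑ qc : Fin bC → Bool, ∑ es : Fin 3 → TVars bA bC r → Bool,
    if q = q then (treeExpr enc encC E leaf (r + 1)).beval ((splitAssign r).symm ((q, qc), es)) else 0) = _
  rw [Finset.sum_congr rfl fun qc _ => Finset.sum_congr rfl fun es _ => by
    rw [if_pos rfl, beval_treeExpr_succ]]
  exact sum_comm_four _

/-- The inner sums at depth `r + 1`: the choice bits select the choice, the subtree sums factor. [cite: BurgisserClausenShokrollahi1997, Thm. (21.26)] -/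
theorem inner_sum_eq (r : ℕ) (q : Fin bA → Bool) (a : At) (c : Ch) :
    (∑ qc : Fin bC → Bool, ∑ es : Fin 3 → TVars bA bC r → Bool,
        ((if enc a = q then (1 : MvPolynomial τ k) else 0) * (if encC c = qc then 1 else 0)) *
          ∏ j : Fin 3, ((if es j ∘ rootA r = enc (E a c j) then (1 : MvPolynomial τ k) else 0) *
            (treeExpr enc encC E leaf r).beval (es j))) =
      (if enc a = q then (1 : MvPolynomial τ k) else 0) *
        ∏ j : Fin 3, fiberSum enc encC E leaf r (enc (E a c j)) := by
  classical
  simp only [mul_assoc, ← Finset.mul_sum]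
  refine congrArg₂ (· * ·) rfl ?_
  rw [← Finset.sum_mul, show (∑ qc : Fin bC → Bool, if encC c = qc then (1 : MvPolynomial τ k) else 0) = 1 by
    rw [Finset.sum_ite_eq]; simp, one_mul]
  rw [← Fintype.prod_sum fun j (e' : TVars bA bC r → Bool) =>
      (if e' ∘ rootA r = enc (E a c j) then (1 : MvPolynomial τ k) else 0) *
        (treeExpr enc encC E leaf r).beval e']
  refine Finset.prod_congr rfl fun j _ => ?_
  unfold fiberSum
  refine Finset.sum_congr rfl fun e' _ => ?_
  split_ifs <;> simp

end Identity

/-- **The tree identity**: summing the tree expression over the Boolean assignments whose root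
atom bits are `q` gives `V_r(a)` if `q` names the atom `a`, and `0` if `q` names no atom. [cite: BurgisserClausenShokrollahi1997, Thm. (21.26)] -/
theorem fiberSum_eq (henc : Function.Injective enc) :
    ∀ (r : ℕ) (q : Fin bA → Bool),
      fiberSum enc encC E leaf r q = ∑ a, if enc a = q then treeVal E leaf r a else 0 := by
  classical
  intro r
  induction r with
  | zero =>
    intro q
    unfold fiberSum
    rw [Finset.sum_eq_single q]
    rotate_left
    · exact fun b _ hb => if_neg hb
    · exact fun h => absurd (Finset.mem_univ _) h
    rw [if_pos]
    swap
    · rfl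
    rw [treeExpr, beval_fsum']
    refine Finset.sum_congr rfl fun a _ => ?_
    rw [beval_mul', ArithExpr.beval_indic, ArithExpr.beval_rename_inl, treeVal]
    have h2 : (q ∘ rootA (bA := bA) (bC := bC) 0 = enc a) ↔ enc a = q := by
      constructor <;> intro h <;> exact h.symm
    rw [if_congr h2 rfl rfl]
    split_ifs <;> simp
  | succ r ih =>
    intro q
    rw [fiberSum_succ]
    refine Finset.sum_congr rfl fun a _ => ?_
    rw [Finset.sum_congr rfl fun c _ => inner_sum_eq r q a c, ← Finset.mul_sum, treeVal]
    simp only [ih, henc.eq_iff, Finset.sum_ite_eq', Finset.mem_univ, if_true]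
    split_ifs <;> simp

/-! #### Size bounds -/

section Size

variable {enc encC E leaf}

omit [Fintype At] [Fintype Ch] in
/-- A list of `n` numbers each `≤ b` sums to `≤ n b`. [folklore] -/
theorem list_sum_map_le {ι : Type*} (l : List ι) (f : ι → ℕ) (b : ℕ) (h : ∀ i ∈ l, f i ≤ b) :
    (l.map f).sum ≤ l.length * b := by
  have := List.sum_le_card_nsmul (l.map f) b (fun x hx => by
    rw [List.mem_map] at hx; obtain ⟨i, hi, rfl⟩ := hx; exact h i hi)
  simpa using this

/-- Size of the local check: at most `|At| (|Ch| (12 bA + 3 bC + 6) + 1)`. [cite: BurgisserClausenShokrollahi1997, Thm. (21.26)] -/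
theorem size_treeChk_le (r : ℕ) :
    (treeChk (k := k) (τ := τ) enc encC E r).size ≤
      Fintype.card At * (Fintype.card Ch * (12 * bA + 3 * bC + 6) + 1) := by
  unfold treeChk
  rw [ArithExpr.size_fsum, Finset.card_univ]
  have hterm : ∀ a c, (ArithExpr.mul (ArithExpr.mul (ArithExpr.indic (k := k) (τ := τ) (rootA (r + 1)) (enc a))
      (ArithExpr.indic (rootC r) (encC c)))
      (ArithExpr.listProd ((List.finRange 3).map fun j =>
        ArithExpr.indic (childVar r j ∘ rootA r) (enc (E a c j))))).size ≤ 12 * bA + 3 * bC + 5 := by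
    intro a c
    simp only [ArithExpr.size_mul, ArithExpr.size_listProd, List.map_map, List.length_map,
      List.length_finRange]
    have h1 := ArithExpr.size_indic_le (k := k) (τ := τ) (rootA (bC := bC) (r + 1)) (enc a)
    have h2 := ArithExpr.size_indic_le (k := k) (τ := τ) (rootC (bA := bA) r) (encC c)
    have h3 := list_sum_map_le (List.finRange 3)
      (ArithExpr.size ∘ fun j => ArithExpr.indic (k := k) (τ := τ) (childVar (bC := bC) r j ∘ rootA r) (enc (E a c j)))
      (3 * bA) (fun j _ => ArithExpr.size_indic_le _ _)
    rw [List.length_finRange] at h3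
    omega
  have hinner : ∀ a, (ArithExpr.fsum Finset.univ fun c =>
      ArithExpr.mul (ArithExpr.mul (ArithExpr.indic (k := k) (τ := τ) (rootA (r + 1)) (enc a))
        (ArithExpr.indic (rootC r) (encC c)))
        (ArithExpr.listProd ((List.finRange 3).map fun j =>
          ArithExpr.indic (childVar r j ∘ rootA r) (enc (E a c j))))).size ≤
      Fintype.card Ch * (12 * bA + 3 * bC + 6) := by
    intro a
    rw [ArithExpr.size_fsum, Finset.card_univ]
    have := Finset.sum_le_card_nsmul Finset.univ _ (12 * bA + 3 * bC + 5) (fun c _ => hterm a c)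
    rw [Finset.card_univ, smul_eq_mul] at this
    nlinarith
  have := Finset.sum_le_card_nsmul Finset.univ _ (Fintype.card Ch * (12 * bA + 3 * bC + 6))
    (fun a _ => hinner a)
  rw [Finset.card_univ, smul_eq_mul] at this
  nlinarith

/-- Size of the depth-`0` tree: at most `|At| (3 bA + Lf + 2)` if the leaves have size `≤ Lf`. [cite: BurgisserClausenShokrollahi1997, Thm. (21.26)] -/
theorem size_treeExpr_zero_le (Lf : ℕ) (hleaf : ∀ a, (leaf a).size ≤ Lf) :
    (treeExpr enc encC E leaf 0).size ≤ Fintype.card At * (3 * bA + Lf + 2) := by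
  rw [treeExpr, ArithExpr.size_fsum, Finset.card_univ]
  have hterm : ∀ a, (ArithExpr.mul (ArithExpr.indic (k := k) (τ := τ) (rootA (bC := bC) 0) (enc a))
      ((leaf a).rename Sum.inl)).size ≤ 3 * bA + Lf + 1 := by
    intro a
    rw [ArithExpr.size_mul, ArithExpr.size_rename]
    have h1 := ArithExpr.size_indic_le (k := k) (τ := τ) (rootA (bC := bC) 0) (enc a)
    have h2 := hleaf a
    omega
  have := Finset.sum_le_card_nsmul Finset.univ _ (3 * bA + Lf + 1) (fun a _ => hterm a)
  rw [Finset.card_univ, smul_eq_mul] at this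
  nlinarith

/-- The size recursion: `size T_{r+1} = size Chk + 3 size T_r + 4`. [cite: BurgisserClausenShokrollahi1997, Thm. (21.26)] -/
theorem size_treeExpr_succ (r : ℕ) :
    (treeExpr enc encC E leaf (r + 1)).size =
      (treeChk (k := k) (τ := τ) enc encC E r).size + 3 * (treeExpr enc encC E leaf r).size + 4 := by
  rw [treeExpr, ArithExpr.size_mul, ArithExpr.size_listProd, List.map_map, List.length_map,
    List.length_finRange]
  have : ((List.finRange 3).map (ArithExpr.size ∘ fun j =>
      (treeExpr enc encC E leaf r).rename (Sum.map id (childVar r j)))).sum =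
      3 * (treeExpr enc encC E leaf r).size := by
    simp [List.finRange_succ, Function.comp_def]
    ring
  rw [this]
  ring

/-- **Size of the tree expression**: `size T_r ≤ 3^r (2 size T₀ + C)` where `C` bounds
`size Chk + 4`. [cite: BurgisserClausenShokrollahi1997, Thm. (21.26)] -/
theorem size_treeExpr_le (C : ℕ) (hC : ∀ r, (treeChk (k := k) (τ := τ) enc encC E r).size + 4 ≤ C) (r : ℕ) :
    (treeExpr enc encC E leaf r).size ≤ 3 ^ r * (2 * (treeExpr enc encC E leaf 0).size + C) := by
  suffices h : 2 * (treeExpr enc encC E leaf r).size + C ≤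
      3 ^ r * (2 * (treeExpr enc encC E leaf 0).size + C) by omega
  induction r with
  | zero => simp
  | succ r ih =>
    rw [size_treeExpr_succ, pow_succ]
    have := hC r
    nlinarith

end Size

/-- **Boolean sum of the tree expression with a root selector**: for a finite family of root
atoms, `∑_e (∑_x [root bits = enc (f x)]) · T_r (e) = ∑_x V_r(f x)`. [cite: BurgisserClausenShokrollahi1997, Thm. (21.26)] -/
theorem sum_beval_select_treeExpr (henc : Function.Injective enc) (r : ℕ) {ι : Type*}
    (s : Finset ι) (f : ι → At) :
    ∑ e : TVars bA bC r → Bool,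
      (ArithExpr.mul (ArithExpr.fsum s fun x => ArithExpr.indic (rootA r) (enc (f x)))
        (treeExpr enc encC E leaf r)).beval e = ∑ x ∈ s, treeVal E leaf r (f x) := by
  classical
  simp only [beval_mul', beval_fsum', ArithExpr.beval_indic, Finset.sum_mul]
  rw [Finset.sum_comm]
  refine Finset.sum_congr rfl fun x _ => ?_
  have : (∑ e : TVars bA bC r → Bool, (if e ∘ rootA r = enc (f x) then (1 : MvPolynomial τ k) else 0) *
      (treeExpr enc encC E leaf r).beval e) = fiberSum enc encC E leaf r (enc (f x)) := by
    unfold fiberSum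
    refine Finset.sum_congr rfl fun e _ => ?_
    split_ifs <;> simp
  rw [this, fiberSum_eq enc encC E leaf henc]
  simp only [henc.eq_iff, Finset.sum_ite_eq', Finset.mem_univ, if_true]

end Tree

/-! ### Instantiation: the expansion tree of a homogeneous circuit certificate -/

section Homogeneous

namespace DepthReduction.HomCircuit

variable {k : Type u} [CommRing k] {τ : Type v} {ι : Type w} [Fintype ι] [DecidableEq ι]
variable (H : HomCircuit k τ ι)

/-- The atoms of the expansion tree: the atoms `[ν]`, `[ν : μ]` of the certificate and the two
constants `0`, `1`. [cite: BurgisserClausenShokrollahi1997, Thm. (21.26)] -/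
abbrev XAtom (ι : Type w) : Type w := Atom ι ⊕ Fin 2

/-- `Atom ι ≃ ι ⊕ ι × ι`. [cite: BurgisserClausenShokrollahi1997, Thm. (21.26)] -/
def atomEquivSum (ι : Type w) : Atom ι ≃ ι ⊕ (ι × ι) where
  toFun a := match a with
    | .node ν => Sum.inl ν
    | .quot ν μ => Sum.inr (ν, μ)
  invFun x := match x with
    | Sum.inl ν => .node ν
    | Sum.inr (ν, μ) => .quot ν μ
  left_inv a := by cases a <;> rfl
  right_inv x := by rcases x with ν | ⟨ν, μ⟩ <;> rfl

/-- The atoms form a finite type. [cite: BurgisserClausenShokrollahi1997, Thm. (21.26)] -/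
instance instFintypeAtom : Fintype (Atom ι) := Fintype.ofEquiv _ (atomEquivSum ι).symm

/-- The atoms have decidable equality. [cite: BurgisserClausenShokrollahi1997, Thm. (21.26)] -/
instance instDecidableEqAtom : DecidableEq (Atom ι) := (atomEquivSum ι).decidableEq

omit [DecidableEq ι] in
/-- `#Atom ι = #ι + #ι²`. [cite: BurgisserClausenShokrollahi1997, Thm. (21.26)] -/
theorem card_atom : Fintype.card (Atom ι) = Fintype.card ι + Fintype.card ι * Fintype.card ι := by
  rw [Fintype.ofEquiv_card, Fintype.card_sum, Fintype.card_prod]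

/-- The value of an extended atom. [cite: BurgisserClausenShokrollahi1997, Thm. (21.26)] -/
def xval : XAtom ι → MvPolynomial τ k
  | Sum.inl a => H.aval a
  | Sum.inr i => if i = 0 then 0 else 1

/-- The constant atom `0`. [cite: BurgisserClausenShokrollahi1997, Thm. (21.26)] -/
abbrev xzero : XAtom ι := Sum.inr 0
/-- The constant atom `1`. [cite: BurgisserClausenShokrollahi1997, Thm. (21.26)] -/
abbrev xone : XAtom ι := Sum.inr 1

omit [Fintype ι] in
/-- Auxiliary (xval xzero). [cite: BurgisserClausenShokrollahi1997, Thm. (21.26)] -/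
@[simp] theorem xval_xzero : H.xval xzero = 0 := rfl
omit [Fintype ι] in
/-- Auxiliary (xval xone). [cite: BurgisserClausenShokrollahi1997, Thm. (21.26)] -/
@[simp] theorem xval_xone : H.xval xone = 1 := by simp [xval]
omit [Fintype ι] in
/-- Auxiliary (xval inl). [cite: BurgisserClausenShokrollahi1997, Thm. (21.26)] -/
@[simp] theorem xval_inl (a : Atom ι) : H.xval (Sum.inl a) = H.aval a := rfl

/-- The trivial term `(0, 1, 1)` (value `0`). [cite: BurgisserClausenShokrollahi1997, Thm. (21.26)] -/
def trivZero : Fin 3 → XAtom ι := ![xzero, xone, xone]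

/-- The trivial expansion of a small atom: `(a, 1, 1)` for the choice `none`, `(0,1,1)` else. [cite: BurgisserClausenShokrollahi1997, Thm. (21.26)] -/
def trivSelf (a : XAtom ι) : Option ι → Fin 3 → XAtom ι
  | none => ![a, xone, xone]
  | some _ => trivZero

/-- **One expansion step** (the frontier identities of Valiant–Skyum–Berkowitz–Rackoff, as in
Tavenas 2015 §5 / `GateQuotients.lean`): a node atom `[ν]` of formal degree `D ≥ 2` expands, for
the choice `γ ∈ F_{D/2}`, into `[ν:γ] · [γ₁] · [γ₂]`; a quotient atom `[ν:μ]` of degree difference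
`D ≥ 2` expands, for `γ ∈ F_{deg μ + D/2}` (with the vanishing terms `deg γ > deg ν` or
`deg heavy(γ) < deg μ` discarded), into `[ν:γ] · [light γ] · [heavy γ : μ]`; every other choice and
every small atom expands trivially (BCS 1997, proof of Thm. (21.26): the recursion
`f_n = ∑ T T S R` of (E)). [cite: BurgisserClausenShokrollahi1997, Thm. (21.26)] -/
def xexpand : XAtom ι → Option ι → Fin 3 → XAtom ι
  | Sum.inl (.node ν), c =>
    if 2 ≤ H.deg ν then
      match c with
      | none => trivZero
      | some γ =>
        if γ ∈ H.frontier (H.deg ν / 2) then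
          ![Sum.inl (.quot ν γ), Sum.inl (.node (H.children γ).1), Sum.inl (.node (H.children γ).2)]
        else trivZero
    else trivSelf (Sum.inl (.node ν)) c
  | Sum.inl (.quot ν μ), c =>
    if 2 ≤ H.deg ν - H.deg μ then
      match c with
      | none => trivZero
      | some γ =>
        if γ ∈ H.frontier (H.deg μ + (H.deg ν - H.deg μ) / 2) ∧ H.deg γ ≤ H.deg ν ∧
            H.deg μ ≤ H.deg (H.heavy (H.children γ).1 (H.children γ).2) then
          ![Sum.inl (.quot ν γ), Sum.inl (.node (H.light (H.children γ).1 (H.children γ).2)),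
            Sum.inl (.quot (H.heavy (H.children γ).1 (H.children γ).2) μ)]
        else trivZero
    else trivSelf (Sum.inl (.quot ν μ)) c
  | Sum.inr b, c => trivSelf (Sum.inr b) c

section ExpandSum

omit [Fintype ι] in
/-- Auxiliary (prod trivZero). [cite: BurgisserClausenShokrollahi1997, Thm. (21.26)] -/
theorem prod_trivZero : ∏ j : Fin 3, H.xval (trivZero j) = 0 := by
  simp [trivZero, Fin.prod_univ_three]

omit [Fintype ι] in
/-- Auxiliary (prod trivSelf none). [cite: BurgisserClausenShokrollahi1997, Thm. (21.26)] -/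
theorem prod_trivSelf_none (a : XAtom ι) : ∏ j : Fin 3, H.xval (trivSelf a none j) = H.xval a := by
  simp [trivSelf, Fin.prod_univ_three]

omit [Fintype ι] in
/-- Auxiliary (prod trivSelf some). [cite: BurgisserClausenShokrollahi1997, Thm. (21.26)] -/
theorem prod_trivSelf_some (a : XAtom ι) (γ : ι) : ∏ j : Fin 3, H.xval (trivSelf a (some γ) j) = 0 := by
  simp [trivSelf, trivZero, Fin.prod_univ_three]

/-- Auxiliary (sum option trivSelf). [cite: BurgisserClausenShokrollahi1997, Thm. (21.26)] -/
theorem sum_option_trivSelf (a : XAtom ι) :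
    ∑ c : Option ι, ∏ j : Fin 3, H.xval (trivSelf a c j) = H.xval a := by
  rw [Fintype.sum_option, prod_trivSelf_none]
  simp [prod_trivSelf_some]

/-- **The expansion identity**: `∑_c ∏_j val (expand a c j) = val a`. [cite: BurgisserClausenShokrollahi1997, Thm. (21.26)] -/
theorem sum_prod_expand (a : XAtom ι) :
    ∑ c : Option ι, ∏ j : Fin 3, H.xval (H.xexpand a c j) = H.xval a := by
  rcases a with (ν | ⟨ν, μ⟩) | b
  · -- node
    by_cases hD : 2 ≤ H.deg ν
    · have hm1 : 1 ≤ H.deg ν / 2 := by omega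
      have hm2 : H.deg ν / 2 < H.deg ν := by omega
      rw [Fintype.sum_option]
      simp only [xexpand, if_pos hD, prod_trivZero, zero_add, xval_inl, aval_node]
      rw [H.val_eq_sum_frontier hm1 hm2, ← Finset.sum_filter_add_sum_filter_not Finset.univ
        (· ∈ H.frontier (H.deg ν / 2))]
      rw [Finset.filter_mem_eq_inter, Finset.univ_inter]
      have hzero : ∑ γ ∈ Finset.univ.filter (fun γ => γ ∉ H.frontier (H.deg ν / 2)),
          ∏ j : Fin 3, H.xval ((if γ ∈ H.frontier (H.deg ν / 2) then
            ![Sum.inl (Atom.quot ν γ), Sum.inl (Atom.node (H.children γ).1),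
              Sum.inl (Atom.node (H.children γ).2)]
          else trivZero) j) = 0 := by
        refine Finset.sum_eq_zero fun γ hγ => ?_
        rw [Finset.mem_filter] at hγ
        rw [if_neg hγ.2, prod_trivZero]
      rw [hzero, add_zero]
      refine Finset.sum_congr rfl fun γ hγ => ?_
      rw [if_pos hγ]
      obtain ⟨hkind, -, -, -⟩ := H.of_mem_frontier hγ
      obtain ⟨-, -, -, hval⟩ := H.wf_prod γ _ _ hkind
      simp [Fin.prod_univ_three, hval, mul_assoc]
    · simp only [xexpand, if_neg hD]
      exact sum_option_trivSelf H _
  · -- quotient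
    by_cases hD : 2 ≤ H.deg ν - H.deg μ
    · set m := H.deg μ + (H.deg ν - H.deg μ) / 2 with hm
      have hm1 : 1 ≤ m := by omega
      have hμm : H.deg μ ≤ m := by omega
      have hm2 : m < H.deg ν := by omega
      rw [Fintype.sum_option]
      simp only [xexpand, if_pos hD, prod_trivZero, zero_add, xval_inl, aval_quot]
      rw [H.quot_eq_sum_frontier hm1 hμm hm2, ← hm, ← Finset.sum_filter_add_sum_filter_not Finset.univ
        (· ∈ H.frontier m), Finset.filter_mem_eq_inter, Finset.univ_inter]
      have hzero : ∑ γ ∈ Finset.univ.filter (fun γ => γ ∉ H.frontier m),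
          ∏ j : Fin 3, H.xval ((if γ ∈ H.frontier m ∧ H.deg γ ≤ H.deg ν ∧
              H.deg μ ≤ H.deg (H.heavy (H.children γ).1 (H.children γ).2) then
            ![Sum.inl (Atom.quot ν γ), Sum.inl (Atom.node (H.light (H.children γ).1 (H.children γ).2)),
              Sum.inl (Atom.quot (H.heavy (H.children γ).1 (H.children γ).2) μ)]
          else trivZero) j) = 0 := by
        refine Finset.sum_eq_zero fun γ hγ => ?_
        rw [Finset.mem_filter] at hγ
        rw [if_neg (fun h => hγ.2 h.1), prod_trivZero]
      rw [hzero, add_zero]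
      refine Finset.sum_congr rfl fun γ hγ => ?_
      obtain ⟨hkind, hdegγ, hc1, hc2⟩ := H.of_mem_frontier hγ
      have hne : γ ≠ μ := fun h => by subst h; omega
      rw [H.quot_prod hkind hne]
      by_cases hcond : H.deg γ ≤ H.deg ν ∧ H.deg μ ≤ H.deg (H.heavy (H.children γ).1 (H.children γ).2)
      · rw [if_pos ⟨hγ, hcond⟩]
        simp [Fin.prod_univ_three, mul_assoc]
      · rw [if_neg (fun h => hcond h.2), prod_trivZero]
        -- the discarded terms vanish
        rcases not_and_or.1 hcond with h1 | h2
        · rw [H.quot_eq_zero_of_deg_lt' (lt_of_not_ge h1), zero_mul]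
        · rw [H.quot_eq_zero_of_deg_lt' (lt_of_not_ge h2), mul_zero, mul_zero]
    · simp only [xexpand, if_neg hD]
      exact sum_option_trivSelf H _
  · simp only [xexpand]
    exact sum_option_trivSelf H _

end ExpandSum

/-! #### The degree invariant -/

/-- An atom is *good with `rem` rounds to go*: a node of formal degree `≤ 2^⌊(rem+1)/2⌋`, a
quotient of degree difference `≤ 2^⌊rem/2⌋`, or a constant. [cite: BurgisserClausenShokrollahi1997, Thm. (21.26)] -/
def IsGood (rem : ℕ) : XAtom ι → Prop
  | Sum.inl (.node ν) => H.deg ν ≤ 2 ^ ((rem + 1) / 2)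
  | Sum.inl (.quot ν μ) => H.deg ν - H.deg μ ≤ 2 ^ (rem / 2)
  | Sum.inr _ => True

section Good

omit [Fintype ι] [DecidableEq ι] in
/-- Auxiliary (isGood xzero). [cite: BurgisserClausenShokrollahi1997, Thm. (21.26)] -/
theorem isGood_xzero (rem : ℕ) : H.IsGood rem xzero := trivial
omit [Fintype ι] [DecidableEq ι] in
/-- Auxiliary (isGood xone). [cite: BurgisserClausenShokrollahi1997, Thm. (21.26)] -/
theorem isGood_xone (rem : ℕ) : H.IsGood rem xone := trivial

omit [Fintype ι] [DecidableEq ι] in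
/-- Auxiliary (isGood trivZero). [cite: BurgisserClausenShokrollahi1997, Thm. (21.26)] -/
theorem isGood_trivZero (rem : ℕ) (j : Fin 3) : H.IsGood rem (trivZero j) := by
  fin_cases j <;> exact trivial

omit [Fintype ι] [DecidableEq ι] in
/-- Auxiliary (isGood trivSelf). [cite: BurgisserClausenShokrollahi1997, Thm. (21.26)] -/
theorem isGood_trivSelf {rem : ℕ} {a : XAtom ι} (ha : H.IsGood rem a) (c : Option ι) (j : Fin 3) :
    H.IsGood rem (trivSelf a c j) := by
  rcases c with _ | γ
  · fin_cases j
    · exact ha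
    · exact trivial
    · exact trivial
  · exact H.isGood_trivZero rem j

omit [Fintype ι] [DecidableEq ι] in
/-- Auxiliary (pow half succ succ). [cite: BurgisserClausenShokrollahi1997, Thm. (21.26)] -/
theorem pow_half_succ_succ (rem : ℕ) : 2 ^ ((rem + 2) / 2) = 2 * 2 ^ (rem / 2) := by
  rw [show (rem + 2) / 2 = rem / 2 + 1 by omega, pow_succ, mul_comm]

omit [Fintype ι] [DecidableEq ι] in
/-- Auxiliary (pow half le). [cite: BurgisserClausenShokrollahi1997, Thm. (21.26)] -/
theorem pow_half_le (rem : ℕ) : 2 ^ (rem / 2) ≤ 2 ^ ((rem + 1) / 2) :=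
  Nat.pow_le_pow_right (by norm_num) (by omega)

/-- **Propagation of goodness**: every atom of the expansion of a good atom (with `rem + 1`
rounds to go) is good with `rem` rounds to go. [cite: BurgisserClausenShokrollahi1997, Thm. (21.26)] -/
theorem isGood_expand {rem : ℕ} {a : XAtom ι} (ha : H.IsGood (rem + 1) a) (c : Option ι) (j : Fin 3) :
    H.IsGood rem (H.xexpand a c j) := by
  rcases a with (ν | ⟨ν, μ⟩) | b
  · change H.deg ν ≤ 2 ^ ((rem + 2) / 2) at ha
    rw [pow_half_succ_succ] at ha
    by_cases hD : 2 ≤ H.deg ν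
    · simp only [xexpand, if_pos hD]
      rcases c with _ | γ
      · exact H.isGood_trivZero rem j
      · dsimp only
        split_ifs with hγ
        · obtain ⟨-, hdegγ, hc1, hc2⟩ := H.of_mem_frontier hγ
          fin_cases j
          · change H.deg ν - H.deg γ ≤ 2 ^ (rem / 2); omega
          · change H.deg (H.children γ).1 ≤ 2 ^ ((rem + 1) / 2)
            exact le_trans (by omega) (pow_half_le rem)
          · change H.deg (H.children γ).2 ≤ 2 ^ ((rem + 1) / 2)
            exact le_trans (by omega) (pow_half_le rem)
        · exact H.isGood_trivZero rem j
    · simp only [xexpand, if_neg hD]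
      apply H.isGood_trivSelf
      change H.deg ν ≤ 2 ^ ((rem + 1) / 2)
      exact le_trans (by omega) (Nat.one_le_two_pow)
  · change H.deg ν - H.deg μ ≤ 2 ^ ((rem + 1) / 2) at ha
    by_cases hD : 2 ≤ H.deg ν - H.deg μ
    · simp only [xexpand, if_pos hD]
      rcases c with _ | γ
      · exact H.isGood_trivZero rem j
      · dsimp only
        split_ifs with hγ
        · obtain ⟨hγ, hγν, hμh⟩ := hγ
          obtain ⟨hkind, hdegγ, hc1, hc2⟩ := H.of_mem_frontier hγ
          have hheavy := H.deg_heavy_le_of hc1 hc2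
          have hsum := H.deg_prod_eq hkind
          have hrem : 1 ≤ rem := by
            by_contra h0
            have : rem = 0 := by omega
            subst this
            simp at ha
            omega
          have hhalf : 2 ^ ((rem + 1) / 2) ≤ 2 * 2 ^ (rem / 2) := by
            rw [← pow_succ']
            exact Nat.pow_le_pow_right (by norm_num) (by omega)
          fin_cases j
          · change H.deg ν - H.deg γ ≤ 2 ^ (rem / 2); omega
          · change H.deg (H.light (H.children γ).1 (H.children γ).2) ≤ 2 ^ ((rem + 1) / 2); omega
          · change H.deg (H.heavy (H.children γ).1 (H.children γ).2) - H.deg μ ≤ 2 ^ (rem / 2); omega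
        · exact H.isGood_trivZero rem j
    · simp only [xexpand, if_neg hD]
      apply H.isGood_trivSelf
      change H.deg ν - H.deg μ ≤ 2 ^ (rem / 2)
      exact le_trans (by omega) (Nat.one_le_two_pow)
  · simp only [xexpand]
    exact isGood_trivSelf H (a := Sum.inr b) trivial c j

omit [Fintype ι] in
/-- **Leaves are affine**: a good atom with no round to go has a value of total degree `≤ 1`. [cite: BurgisserClausenShokrollahi1997, Thm. (21.26)] -/
theorem totalDegree_xval_le_one {a : XAtom ι} (ha : H.IsGood 0 a) : (H.xval a).totalDegree ≤ 1 := by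
  rcases a with (ν | ⟨ν, μ⟩) | b
  · change H.deg ν ≤ 2 ^ 0 at ha
    exact (H.totalDegree_val_le ν).trans (by simpa using ha)
  · change H.deg ν - H.deg μ ≤ 2 ^ 0 at ha
    exact (H.totalDegree_quot_le ν μ).trans (by simpa using ha)
  · simp only [xval]
    split_ifs <;> simp

end Good

/-! #### The tree of a certificate -/

section HTree

variable [Fintype τ] [DecidableEq τ]

/-- One-hot encoding of a finite type by bit vectors of length `#α`. [cite: BurgisserClausenShokrollahi1997, Thm. (21.26)] -/
def oneHot (α : Type*) [Fintype α] [DecidableEq α] (a : α) : Fin (Fintype.card α) → Bool :=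
  fun i => decide (i = Fintype.equivFin α a)

omit [Fintype ι] [DecidableEq ι] [Fintype τ] [DecidableEq τ] in
/-- The one-hot encoding is injective. [cite: BurgisserClausenShokrollahi1997, Thm. (21.26)] -/
theorem oneHot_injective (α : Type*) [Fintype α] [DecidableEq α] : Function.Injective (oneHot α) := by
  intro a b h
  have := congrFun h (Fintype.equivFin α a)
  simp only [oneHot, decide_true] at this
  have h2 : Fintype.equivFin α a = Fintype.equivFin α b := by
    by_contra hne
    rw [decide_eq_false hne] at this
    exact Bool.noConfusion this
  exact (Fintype.equivFin α).injective h2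

/-- The leaf expressions: the affine truncations of the atom values (equal to the values for
good leaves). [cite: BurgisserClausenShokrollahi1997, Thm. (21.26)] -/
def leafExpr (a : XAtom ι) : ArithExpr k τ := ArithExpr.affineExpr τ (H.xval a)

/-- The iterated expansion values of the certificate tree. [cite: BurgisserClausenShokrollahi1997, Thm. (21.26)] -/
abbrev hTreeVal (rem : ℕ) (a : XAtom ι) : MvPolynomial τ k := treeVal H.xexpand H.leafExpr rem a

omit [DecidableEq τ] in
/-- **The iterated expansion computes the value** of every good atom. [cite: BurgisserClausenShokrollahi1997, Thm. (21.26)] -/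
theorem hTreeVal_eq : ∀ (rem : ℕ) (a : XAtom ι), H.IsGood rem a → hTreeVal H rem a = H.xval a := by
  intro rem
  induction rem with
  | zero =>
    intro a ha
    change (H.leafExpr a).eval = H.xval a
    rw [leafExpr, ArithExpr.eval_affineExpr]
    exact affinePart_eq_of_totalDegree_le_one (H.totalDegree_xval_le_one ha)
  | succ rem ih =>
    intro a ha
    change ∑ c, ∏ j : Fin 3, treeVal H.xexpand H.leafExpr rem (H.xexpand a c j) = H.xval a
    rw [← H.sum_prod_expand a]
    refine Finset.sum_congr rfl fun c _ => Finset.prod_congr rfl fun j _ => ?_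
    exact ih _ (H.isGood_expand ha c j)

/-- The tree expression of the certificate, with a selector of a family of root atoms:
`(∑_x [root bits = enc (f x)]) · T_R`. [cite: BurgisserClausenShokrollahi1997, Thm. (21.26)] -/
def hTreeExpr (R : ℕ) {κ : Type*} (s : Finset κ) (f : κ → XAtom ι) :
    ArithExpr k (τ ⊕ TVars (Fintype.card (XAtom ι)) (Fintype.card (Option ι)) R) :=
  ArithExpr.mul (ArithExpr.fsum s fun x => ArithExpr.indic (rootA R) (oneHot (XAtom ι) (f x)))
    (treeExpr (oneHot (XAtom ι)) (oneHot (Option ι)) H.xexpand H.leafExpr R)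

omit [DecidableEq τ] in
/-- **The Boolean sum of the certificate tree** is the sum of the values of the selected root
atoms, provided they are good with `R` rounds to go. [cite: BurgisserClausenShokrollahi1997, Thm. (21.26)] -/
theorem sum_beval_hTreeExpr (R : ℕ) {κ : Type*} (s : Finset κ) (f : κ → XAtom ι)
    (hf : ∀ x ∈ s, H.IsGood R (f x)) :
    ∑ e : TVars (Fintype.card (XAtom ι)) (Fintype.card (Option ι)) R → Bool, (H.hTreeExpr R s f).beval e =
      ∑ x ∈ s, H.xval (f x) := by
  rw [hTreeExpr, sum_beval_select_treeExpr _ _ _ _ (oneHot_injective _)]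
  exact Finset.sum_congr rfl fun x hx => hTreeVal_eq H R (f x) (hf x hx)

omit [DecidableEq τ] in
/-- Size of the certificate tree expression (crude polynomial bound): with `I = #ι`, `n = #τ`,
`bA = I + I² + 2`, `bC = I + 1`,
`size ≤ (3 bA + 1) #s + 1 + 3^R (2 bA (3 bA + 2n + 3) + bA ((I+1)(12 bA + 3 bC + 6) + 1) + 4)`. [cite: BurgisserClausenShokrollahi1997, Thm. (21.26)] -/
theorem size_hTreeExpr_le (R : ℕ) {κ : Type*} (s : Finset κ) (f : κ → XAtom ι) :
    (H.hTreeExpr R s f).size ≤ (3 * Fintype.card (XAtom ι) + 1) * s.card + 1 +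
      3 ^ R * (2 * (Fintype.card (XAtom ι) * (3 * Fintype.card (XAtom ι) + (2 * Fintype.card τ + 1) + 2)) +
        (Fintype.card (XAtom ι) * (Fintype.card (Option ι) * (12 * Fintype.card (XAtom ι) +
          3 * Fintype.card (Option ι) + 6) + 1) + 4)) := by
  rw [hTreeExpr, ArithExpr.size_mul, ArithExpr.size_fsum]
  have h1 := Finset.sum_le_card_nsmul s (fun x => (ArithExpr.indic (k := k) (τ := τ)
    (rootA (bC := Fintype.card (Option ι)) R) (oneHot (XAtom ι) (f x))).size) (3 * Fintype.card (XAtom ι))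
    (fun x _ => ArithExpr.size_indic_le _ _)
  rw [smul_eq_mul] at h1
  have h2 := size_treeExpr_le (enc := oneHot (XAtom ι)) (encC := oneHot (Option ι)) (E := H.xexpand)
    (leaf := H.leafExpr) _ (fun r => Nat.add_le_add_right (size_treeChk_le r) 4) R
  have h3 := size_treeExpr_zero_le (enc := oneHot (XAtom ι)) (encC := oneHot (Option ι)) (E := H.xexpand)
    (leaf := H.leafExpr) (2 * Fintype.card τ + 1) (fun a => le_of_eq (ArithExpr.size_affineExpr _))
  nlinarith [Nat.one_le_pow R 3 (by norm_num)]

end HTree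

end DepthReduction.HomCircuit

end Homogeneous

/-! ### From a circuit to a Boolean sum of an expression (VP ⊆ VNP_e for one polynomial) -/

section OnePolynomial

open DepthReduction DepthReduction.HomCircuit

variable {k : Type u} [CommRing k] {τ : Type v} [Fintype τ]

/-- The node-count bound `I(s, d) = 4 s (d+1)²` of the homogenization. [cite: BurgisserClausenShokrollahi1997, Thm. (21.26)] -/
def vnpeI (s d : ℕ) : ℕ := 4 * s * (d + 1) ^ 2

/-- The number `R(d) = 2 (log₂ d + 1)` of expansion rounds. [cite: BurgisserClausenShokrollahi1997, Thm. (21.26)] -/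
def vnpeR (d : ℕ) : ℕ := 2 * (Nat.log 2 d + 1)

/-- The size bound of the tree expression as a function of `bA` (atom bits), `bC` (choice
bits), `n` (number of `X`-variables), `R` (rounds) and `q` (number of roots). [cite: BurgisserClausenShokrollahi1997, Thm. (21.26)] -/
def vnpeF (bA bC n R q : ℕ) : ℕ :=
  (3 * bA + 1) * q + 1 + 3 ^ R * (2 * (bA * (3 * bA + (2 * n + 1) + 2)) +
    (bA * (bC * (12 * bA + 3 * bC + 6) + 1) + 4))

/-- Bound on the number of Boolean variables. [cite: BurgisserClausenShokrollahi1997, Thm. (21.26)] -/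
def vnpeVars (s d : ℕ) : ℕ :=
  3 ^ vnpeR d * (3 * (vnpeI s d + vnpeI s d * vnpeI s d + 2) + (vnpeI s d + 1))

/-- Bound on the expression size. [cite: BurgisserClausenShokrollahi1997, Thm. (21.26)] -/
def vnpeSize (s d n : ℕ) : ℕ :=
  vnpeF (vnpeI s d + vnpeI s d * vnpeI s d + 2) (vnpeI s d + 1) n (vnpeR d) (d + 1)

omit [CommRing k] [Fintype τ] in
/-- `vnpeF` is monotone in the bit counts. [cite: BurgisserClausenShokrollahi1997, Thm. (21.26)] -/
theorem vnpeF_mono {bA bA' bC bC' : ℕ} (hA : bA ≤ bA') (hC : bC ≤ bC') (n R q : ℕ) :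
    vnpeF bA bC n R q ≤ vnpeF bA' bC' n R q := by
  unfold vnpeF
  gcongr

omit [CommRing k] [Fintype τ] in
/-- The roots are good: `d < 2^{⌊(R(d)+1)/2⌋}`. [cite: BurgisserClausenShokrollahi1997, Thm. (21.26)] -/
theorem deg_lt_two_pow_half_vnpeR (d : ℕ) : d < 2 ^ ((vnpeR d + 1) / 2) := by
  rw [vnpeR, show (2 * (Nat.log 2 d + 1) + 1) / 2 = Nat.log 2 d + 1 by omega]
  exact Nat.lt_pow_succ_log_self (by norm_num) d

/-- **`VP ⊆ VNP_e` for one polynomial** (BCS 1997, Thm. (21.26), the statement behind Lemma (21.22)):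
a polynomial `g` in `n` variables of total degree `≤ d` computed by a fan-in-two circuit of size
`s` is the Boolean sum `g = ∑_{e ∈ {0,1}^m} val(ψ)(X, e)` of an expression `ψ` with
`m ≤ vnpeVars s d` Boolean variables and `E(ψ) ≤ vnpeSize s d n`. [cite: BurgisserClausenShokrollahi1997, Thm. (21.26)] -/
theorem exists_expr_boolSum_of_circuit (g : MvPolynomial τ k) (P : ArithCircuit k τ)
    (hP2 : P.IsFanInTwo) (hPg : P.Computes g) (d : ℕ) (hd : g.totalDegree ≤ d) :
    ∃ (m : ℕ) (ψ : ArithExpr k (τ ⊕ Fin m)), boolSum ψ.eval = g ∧ m ≤ vnpeVars P.size d ∧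
      ψ.size ≤ vnpeSize P.size d (Fintype.card τ) := by
  classical
  obtain ⟨S, hlen, hcases⟩ := DepthReduction.exists_slp P hP2
  unfold ArithCircuit.Computes at hPg
  rcases hcases with ⟨i, hi, hval⟩ | ⟨j, hj⟩ | ⟨c, hc⟩
  · -- main case: `g` is a value of the straight-line program
    set H := S.homogenize d with hH
    set bA := Fintype.card (XAtom (S.Node d)) with hbA
    set bC := Fintype.card (Option (S.Node d)) with hbC
    set R := vnpeR d with hR
    let f : Fin (d + 1) → XAtom (S.Node d) := fun e => Sum.inl (.node (⟨i, hi⟩, SLP.Tag.Q e))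
    have hgood : ∀ e ∈ (Finset.univ : Finset (Fin (d + 1))), H.IsGood R (f e) := by
      intro e _
      change H.deg (⟨i, hi⟩, SLP.Tag.Q e) ≤ 2 ^ ((R + 1) / 2)
      have : H.deg (⟨i, hi⟩, SLP.Tag.Q e) = e.val := rfl
      rw [this]
      have := deg_lt_two_pow_half_vnpeR d
      rw [← hR] at this
      have he := e.isLt
      omega
    set Φ := H.hTreeExpr R Finset.univ f with hΦ
    have hsumΦ : ∑ e : TVars bA bC R → Bool, Φ.beval e = g := by
      rw [hΦ, H.sum_beval_hTreeExpr R Finset.univ f hgood]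
      have hcomp : ∀ e : Fin (d + 1), H.xval (f e) = homogeneousComponent e.val g := by
        intro e
        change H.aval (.node (⟨i, hi⟩, SLP.Tag.Q e)) = _
        rw [HomCircuit.aval_node]
        change S.hval d (⟨i, hi⟩, SLP.Tag.Q e) = _
        rw [SLP.hval_Q, ← hval, hPg]
      simp only [hcomp]
      rw [Fin.sum_univ_eq_sum_range (fun e => homogeneousComponent e g) (d + 1)]
      exact DepthReduction.sum_homogeneousComponent_of_le hd
    -- rename the Boolean variables into `Fin m`
    set m := Fintype.card (TVars bA bC R) with hm
    let θ : TVars bA bC R ≃ Fin m := Fintype.equivFin _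
    refine ⟨m, Φ.rename (Sum.map id θ), ?_, ?_, ?_⟩
    · rw [boolSum_eq_sum_beval, sum_beval_rename_equiv θ Φ, hsumΦ]
    · -- number of variables
      have hI : Fintype.card (S.Node d) ≤ vnpeI P.size d := by
        rw [vnpeI, ← hlen]; exact SLP.card_node_le S d
      have hbA' : bA ≤ vnpeI P.size d + vnpeI P.size d * vnpeI P.size d + 2 := by
        rw [hbA, Fintype.card_sum, HomCircuit.card_atom, Fintype.card_fin]
        nlinarith
      have hbC' : bC ≤ vnpeI P.size d + 1 := by
        rw [hbC, Fintype.card_option]; omega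
      calc m ≤ 3 ^ R * (3 * bA + bC) := card_TVars_le R
        _ ≤ vnpeVars P.size d := by
          rw [vnpeVars, ← hR]
          gcongr
    · -- size
      rw [ArithExpr.size_rename, hΦ]
      have hI : Fintype.card (S.Node d) ≤ vnpeI P.size d := by
        rw [vnpeI, ← hlen]; exact SLP.card_node_le S d
      have hbA' : bA ≤ vnpeI P.size d + vnpeI P.size d * vnpeI P.size d + 2 := by
        rw [hbA, Fintype.card_sum, HomCircuit.card_atom, Fintype.card_fin]
        nlinarith
      have hbC' : bC ≤ vnpeI P.size d + 1 := by
        rw [hbC, Fintype.card_option]; omega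
      refine (H.size_hTreeExpr_le R Finset.univ f).trans ?_
      rw [Finset.card_univ, Fintype.card_fin, vnpeSize, ← hbA, ← hbC, ← hR]
      exact vnpeF_mono hbA' hbC' _ _ _
  · -- `g = X j`
    refine ⟨0, ArithExpr.var (Sum.inl j), ?_, Nat.zero_le _, Nat.zero_le _⟩
    rw [← hPg, hj]
    simp [boolSum, ArithExpr.eval]
  · -- `g = C c`
    refine ⟨0, ArithExpr.const c, ?_, Nat.zero_le _, Nat.zero_le _⟩
    rw [← hPg, hc]
    simp [boolSum, ArithExpr.eval]

end OnePolynomial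

/-! ### Nesting Boolean sums and the family statement -/

section Family

variable {k : Type u} [CommRing k]

/-- **Nesting of Boolean sums** (BCS 1997, proof of Lemma (21.22): `∑_{e,e'} h(X,e,e')` is one
Boolean sum): a Boolean sum over `Fin b` of a Boolean sum over `Fin a` is the Boolean sum over
`Fin (a + b)` of the renamed polynomial. [cite: BurgisserClausenShokrollahi1997, Lemma (21.22)] -/
theorem boolSum_boolSum {σ : Type*} {a b : ℕ} (h : MvPolynomial ((σ ⊕ Fin a) ⊕ Fin b) k) :
    boolSum (boolSum h) = boolSum (MvPolynomial.rename
      ((Equiv.sumAssoc σ (Fin a) (Fin b)).trans (Equiv.sumCongr (Equiv.refl σ) finSumFinEquiv)) h) := by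
  classical
  unfold boolSum
  simp only [map_sum, aeval_rename]
  rw [Finset.sum_comm]
  symm
  refine (Fintype.sum_equiv ((finSumFinEquiv.symm.arrowCongr (Equiv.refl Bool)).trans
    (Equiv.sumArrowEquivProdArrow (Fin a) (Fin b) Bool)) _
    (fun p : (Fin a → Bool) × (Fin b → Bool) =>
      aeval (Sum.elim X fun j => if p.1 j then (1 : MvPolynomial σ k) else 0)
        (aeval (Sum.elim X fun j => if p.2 j then (1 : MvPolynomial (σ ⊕ Fin a) k) else 0) h))
    (fun e => ?_)).trans ?_
  · rw [← AlgHom.comp_apply, MvPolynomial.comp_aeval]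
    congr 2
    funext x
    rcases x with (t | i) | j
    · simp
    · simp [Equiv.arrowCongr, Equiv.sumArrowEquivProdArrow]
    · simp only [Function.comp_apply, Equiv.coe_trans, Equiv.sumAssoc_apply_inr, Equiv.sumCongr_apply,
        Sum.map_inr, Sum.elim_inr]
      split_ifs with h1 h2 h2 <;> simp_all [Equiv.arrowCongr, Equiv.sumArrowEquivProdArrow]
  · rw [Fintype.sum_prod_type, Finset.sum_comm]

/-- `3^{R(d)} ≤ 9 (d+1)^4`. [cite: BurgisserClausenShokrollahi1997, Thm. (21.26)] -/
theorem three_pow_vnpeR_le (d : ℕ) : 3 ^ vnpeR d ≤ 9 * (d + 1) ^ 4 := by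
  rw [vnpeR, pow_mul, show (3 : ℕ) ^ 2 = 9 by norm_num, pow_succ, mul_comm]
  apply Nat.mul_le_mul_left
  calc 9 ^ Nat.log 2 d ≤ 16 ^ Nat.log 2 d := Nat.pow_le_pow_left (by norm_num) _
    _ = (2 ^ Nat.log 2 d) ^ 4 := by rw [← pow_mul, mul_comm, pow_mul]; norm_num
    _ ≤ (d + 1) ^ 4 := by
        apply Nat.pow_le_pow_left
        rcases Nat.eq_zero_or_pos d with rfl | hd
        · simp
        · exact (Nat.pow_log_le_self 2 hd.ne').trans (Nat.le_succ d)

/-- p-boundedness of `vnpeI` along p-bounded size and degree. [cite: BurgisserClausenShokrollahi1997, Thm. (21.26)] -/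
theorem isPBounded_vnpeI {s d : ℕ → ℕ} (hs : IsPBounded s) (hd : IsPBounded d) :
    IsPBounded fun n => vnpeI (s n) (d n) := by
  unfold vnpeI
  exact IsPBounded.mul_holds (IsPBounded.mul_holds (IsPBounded.const 4) hs)
    (IsPBounded.pow_holds (IsPBounded.add_holds hd (IsPBounded.const 1)) 2)

/-- p-boundedness of `3^{R(d)}`. [cite: BurgisserClausenShokrollahi1997, Thm. (21.26)] -/
theorem isPBounded_three_pow_vnpeR {d : ℕ → ℕ} (hd : IsPBounded d) :
    IsPBounded fun n => 3 ^ vnpeR (d n) :=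
  (IsPBounded.mul_holds (IsPBounded.const 9)
    (IsPBounded.pow_holds (IsPBounded.add_holds hd (IsPBounded.const 1)) 4)).mono
    fun n => three_pow_vnpeR_le (d n)

/-- p-boundedness of `vnpeVars`. [cite: BurgisserClausenShokrollahi1997, Thm. (21.26)] -/
theorem isPBounded_vnpeVars {s d : ℕ → ℕ} (hs : IsPBounded s) (hd : IsPBounded d) :
    IsPBounded fun n => vnpeVars (s n) (d n) := by
  have hI := isPBounded_vnpeI hs hd
  unfold vnpeVars
  exact IsPBounded.mul_holds (isPBounded_three_pow_vnpeR hd)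
    (IsPBounded.add_holds (IsPBounded.mul_holds (IsPBounded.const 3)
      (IsPBounded.add_holds (IsPBounded.add_holds hI (IsPBounded.mul_holds hI hI)) (IsPBounded.const 2)))
      (IsPBounded.add_holds hI (IsPBounded.const 1)))

/-- p-boundedness of `vnpeF`. [cite: BurgisserClausenShokrollahi1997, Thm. (21.26)] -/
theorem isPBounded_vnpeF {bA bC nn R3 q : ℕ → ℕ} (hA : IsPBounded bA) (hC : IsPBounded bC)
    (hn : IsPBounded nn) (hR : IsPBounded R3) (hq : IsPBounded q) :
    IsPBounded fun n => (3 * bA n + 1) * q n + 1 + R3 n * (2 * (bA n * (3 * bA n + (2 * nn n + 1) + 2)) +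
      (bA n * (bC n * (12 * bA n + 3 * bC n + 6) + 1) + 4)) := by
  refine IsPBounded.add_holds (IsPBounded.add_holds (IsPBounded.mul_holds (IsPBounded.add_holds
    (IsPBounded.mul_holds (IsPBounded.const 3) hA) (IsPBounded.const 1)) hq) (IsPBounded.const 1)) ?_
  refine IsPBounded.mul_holds hR (IsPBounded.add_holds ?_ ?_)
  · exact IsPBounded.mul_holds (IsPBounded.const 2) (IsPBounded.mul_holds hA
      (IsPBounded.add_holds (IsPBounded.add_holds (IsPBounded.mul_holds (IsPBounded.const 3) hA)
        (IsPBounded.add_holds (IsPBounded.mul_holds (IsPBounded.const 2) hn) (IsPBounded.const 1)))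
        (IsPBounded.const 2)))
  · exact IsPBounded.add_holds (IsPBounded.mul_holds hA (IsPBounded.add_holds (IsPBounded.mul_holds hC
      (IsPBounded.add_holds (IsPBounded.add_holds (IsPBounded.mul_holds (IsPBounded.const 12) hA)
        (IsPBounded.mul_holds (IsPBounded.const 3) hC)) (IsPBounded.const 6))) (IsPBounded.const 1)))
      (IsPBounded.const 4)

/-- p-boundedness of `vnpeSize`. [cite: BurgisserClausenShokrollahi1997, Thm. (21.26)] -/
theorem isPBounded_vnpeSize {s d nn : ℕ → ℕ} (hs : IsPBounded s) (hd : IsPBounded d) (hn : IsPBounded nn) :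
    IsPBounded fun n => vnpeSize (s n) (d n) (nn n) := by
  have hI := isPBounded_vnpeI hs hd
  have h := isPBounded_vnpeF (bA := fun n => vnpeI (s n) (d n) + vnpeI (s n) (d n) * vnpeI (s n) (d n) + 2)
    (bC := fun n => vnpeI (s n) (d n) + 1) (nn := nn) (R3 := fun n => 3 ^ vnpeR (d n)) (q := fun n => d n + 1)
    (IsPBounded.add_holds (IsPBounded.add_holds hI (IsPBounded.mul_holds hI hI)) (IsPBounded.const 2))
    (IsPBounded.add_holds hI (IsPBounded.const 1)) hn (isPBounded_three_pow_vnpeR hd)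
    (IsPBounded.add_holds hd (IsPBounded.const 1))
  exact h

end Family

end Literature.Computability.AlgebraicComplexity

/-! ### Discharge of the named fact -/

namespace Literature.Computability.AlgebraicComplexity

universe u'

/-- **Discharge of `BCS1997_thm_21_26`** (`VNP ⊆ VNP_e`, Valiant 1982; BCS 1997, Thm. (21.26)):
every p-definable family `f_n = ∑_e g_n(X, e)`, `g ∈ VP`, is a Boolean sum
`f_n = ∑_{e'} val(φ_n)(X, e')` of expressions `φ_n` of p-bounded size in p-boundedly many
Boolean variables: take a size-`L(g_n)` circuit for `g_n`, expand it (`exists_expr_boolSum_of_circuit`)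
and merge the two Boolean sums (`boolSum_boolSum`). [cite: BurgisserClausenShokrollahi1997, Thm. (21.26)] -/
theorem BCS1997_thm_21_26_holds (k : Type u') [Field k] : BCS1997_thm_21_26 k := by
  intro v f hf
  obtain ⟨-, u, g, ⟨⟨hvars, hdeg⟩, hcomp⟩, hfg⟩ := hf
  have key : ∀ n, ∃ (m : ℕ) (ψ : ArithExpr k ((Fin (v n) ⊕ Fin (u n)) ⊕ Fin m)),
      boolSum ψ.eval = g n ∧ m ≤ vnpeVars (complexity (g n)) ((g n).totalDegree) ∧
      ψ.size ≤ vnpeSize (complexity (g n)) ((g n).totalDegree) (v n + u n) := by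
    intro n
    obtain ⟨P, hP2, hPg, hPs⟩ := ArithCircuit.exists_computes_size_eq_complexity (g n)
    obtain ⟨m, ψ, h1, h2, h3⟩ := exists_expr_boolSum_of_circuit (g n) P hP2 hPg _ le_rfl
    refine ⟨m, ψ, h1, hPs ▸ h2, ?_⟩
    rw [hPs] at h3
    simpa [Fintype.card_sum, Fintype.card_fin] using h3
  choose m ψ hψ hm hsz using key
  have hvu : IsPBounded fun n => v n + u n := by
    refine hvars.mono fun n => ?_
    simp [Fintype.card_sum, Fintype.card_fin]
  refine ⟨fun n => u n + m n, fun n => vnpeSize (complexity (g n)) ((g n).totalDegree) (v n + u n),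
    ?_, isPBounded_vnpeSize hcomp hdeg hvu, fun n => (ψ n).rename
      ((Equiv.sumAssoc _ _ _).trans (Equiv.sumCongr (Equiv.refl _) finSumFinEquiv)), ?_, ?_⟩
  · exact IsPBounded.add_holds (hvu.mono fun n => Nat.le_add_left _ _)
      ((isPBounded_vnpeVars hcomp hdeg).mono hm)
  · intro n
    rw [ArithExpr.size_rename]
    exact hsz n
  · intro n
    rw [hfg n, ← hψ n, ArithExpr.eval_rename, boolSum_boolSum]

end Literature.Computability.AlgebraicComplexity
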